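import Summits.BirchSwinnertonDyer.Rank1Residual.O5.HeegnerLogTransportThreeKrizLiGlue
import Literature.NumberTheory.EllipticCurves.KrizLi2019.EisensteinHeegnerLog
import Literature.NumberTheory.EllipticCurves.BSDHeegnerPointsModularityOnlyProofs
import Literature.NumberTheory.EllipticCurves.LeadingTermProofs
import HarnessLib

/-!
# Crux 3 `MazurMCOnCellB` (stmt-BirchSwinnertonDyer-19033), line `twistback` v4 — road (c)/(d) into stub 6:
# the partner's analytic rank `r_an(E^{(d_K)}) = 1` from a HEEGNER POINT OF INFINITE ORDER (Gross–Zagier +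
# modularity only), and Kriz–Li 2019 Thm. 1.20's "in particular" clause in the tree's vocabulary

Width seat bsd-line-x2-p1-w6 (g0), 2026-08-28. HONEST FRAMING (cell `bsd-eis`, run/shared/lean/pub/bsd-eis/):
conditional theorems only; inputs BY NAME = two conjuncts of the route's `PublishedInputs` (stmt-…-19037: modularity
`exists_isNewformOf` and Gross–Zagier `gross_zagier N W K`) and — in §3 only — Kriz–Li, Forum Math. Sigma 7 (2019)
e15, **Thm. 1.20 (= Thm. 7.1, first alternative)**, ALREADY TYPED in the tree as the named fact
`Literature.NumberTheory.EllipticCurves.KrizLi2019.thm120_padicLogHeegner_unit_of_bernoulli`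
(`KrizLi2019/EisensteinHeegnerLog.lean`; nothing asserted there, taken here as the hypothesis `h120`). No new
definition, no new named fact, no `sorry`. Nothing is booked; no main conjecture / BSD is proved for any curve; 0
cells / labels / tiers move; no summit statement is proved by this seat.

WHY (LEAD g10 verdict `Cruxes/MazurMCOnCellB/Lines/twistback-lead-verdict-g10.md` §2/§4, HANDOFF NEXT (2)+(3)):
on road (c)/(d) Mazur's MC at a NON-split X2b pair `(W, p)` follows (p645525 §2/§3) from STEP L at one Heegner datum
and ONE admissible `K` with (i) `ord_{s=1} L(E^{(d_K)}, s) = 1`, (ii) a KL-flat carrier of the twist, (iii) local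
balance `1`. So far (i) is a per-pair INPUT (`hr1` / `hrd`; on the census a PARI `ellanalyticrank` reading, lam-a
g16 j311785: 132/132). §2 of this file turns (i) into the statement that ONE Heegner point `P_K ∈ E(K)` has
infinite order — a statement that is (a) EXACTLY CERTIFIABLE per pair (a point of `E(K)` with explicit coordinates,
on the curve, outside the finite torsion subgroup), unlike an analytic rank, and (b) the OUTPUT of every printed
non-torsion criterion: Gross–Zagier at `(N_E, W, K)` + the odd sign under the Heegner hypothesis (modularity) give
`ord_{s=1} L(E/K, s) = 1 ⟺ P_K ∉ E(K)_tors` (tree `analyticRankEK_eq_one_iff_heegner_nonTorsion_of_exists_isNewformOf`),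
and the Artin factorisation `ord L(E/K) = ord L(E) + ord L(E^{(d_K)})` (tree `analyticRankEK_eq_add_of`) with
`ord L(E) = 0` (X2b) gives (i). §3 records Kriz–Li's own non-torsion criterion (Thm. 1.20, BY NAME) in this form —
its printed "In particular, `P ∈ E(K)` is of infinite order and `E/K` has analytic … rank `1`" clause, which the
typed fact leaves to the consumer — for ANY odd Eisenstein prime `p` and any conductor ("does not require `p ∤ N`",
FMS p. 42).

SCOPE NOTE (LEAD g10 caution, bsd-eis STATUS 2026-08-28T16:25:09Z; w5 g0 16:28:37Z; this seat's bookkeeping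
concurs): Thm. 1.20's hypotheses (2) «no split multiplicative prime» and (3) «`ψ(ℓ) ≠ 1 ≠ (ψ⁻¹ω)(ℓ)` at additive
`ℓ ≠ p`» say, in the λ-bookkeeping of p645419 §1, that the local balance `c(E)` is `0`, whereas at a NON-split X2b
pair `c(E)` is odd (= `1` on 30/44 A10 cells, `≥ 3` on the rest; lam-a g16 l.3286): so §3 serves NO X2b pair at
`p = 3`, and NO composition of §3 with the balance-`1` door p645525 §2/§3 is offered here (it would have jointly
unsatisfiable hypotheses on the row). §3 is kept for the rows where `c(E) = 0` is possible (rank-zero curves at an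
odd Eisenstein prime with no split multiplicative prime, e.g. good `p`); §1–§2 are what road (d) uses: per pair with
a Heegner-point certificate, class-wide with any producer of a non-torsion Heegner point.

* §1 `not_isOfFinAddOrder_of_padicLogOmega_ne_zero` — `log_{ω_E} P ≠ 0 ⟹ P ∉ E(K)_tors` (O5 glue
  `padicLogOmega_eq_padicLog` + the Additive cell's `padicLog_eq_zero_iff`); `…_of_not_norm_le` for the displayed
  shape `¬ ‖e · (log_{ω_𝓔} P / c)‖ ≤ p⁻¹` of Thm. 1.20's conclusion.
* §2 `analyticRank_twist_eq_one_of_isHeegnerPoint_of_not_isOfFinAddOrder` — `r_an(E) = 0`, `K` imaginary quadratic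
  Heegner for `N_E`, a Heegner point of level `N_E` of infinite order ⟹ `(W.quadraticTwist d_K).analyticRank = 1`,
  from `gross_zagier` + `exists_isNewformOf` ALONE (Literature level; no Kolyvagin, no GZK) — the `hr1` input of
  p645525 §3 `upperPartner_at_of_klFlat_partner` / `hrd` of §2 there, for the twist's model via `analyticRank_smul`.
* §3 `analyticRank_twist_eq_one_of_thm120` — Thm. 1.20's binders verbatim (trace-form `ψ`, Teichmüller `ω`, (1)–(3),
  `K` Heegner with `p` split, `ε_K`, `D/H/ι/ιp/P`, the Bernoulli unit `B_{1,ψ₀⁻¹ε_K}·B_{1,ψ₀ω⁻¹} ≢ 0 (mod p)`) +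
  `r_an(W) = 0` ⟹ `r_an(E^{(d_K)}) = 1`. CONDITIONAL on `h120`, `hGZ`, `hnf`.

What remains OPEN on road (d) (honest): per pair, the KL-flat CARRIER (LEAD g10's bricks F1–F3) and STEP L (item
-27489, modulo Keller–Yin Thm. D PRE, or w8 g0's Kriz–Li-locus discharge); class-wide, the JOINT supply of ONE
admissible `K` with `r_an(E^{(d_K)}) = 1` AND `3 ∤ h(ℚ(√(D·d_K)))` — NOT in print for X2b (Kriz–Li's joint
statements, Thm. 9.4 second assertion / Thm. 9.7, impose Thm. 1.20's hypotheses on the curve carrying the Heegner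
point, i.e. on a TWIST `E^{(d)}` chosen by their Thm. 9.5, not on `E`); in print separately: the class-number half
(Thm. 9.4 first assertion = Nakagawa–Horie 1988 Thm. 1 + Taya 2000, not yet typed for a general `E`) and the rank
half (Bump–Friedberg–Hoffstein, already in `stub_printedFacts`).

References: [KrizLi2019] Thm. 1.20 (pp. 7–8) = Thm. 7.1 (pp. 42–43), Rem. 1.17, §2 (pp. 11–12), (29) (pp. 49–50),
§9 (Thm. 9.4, Thm. 9.5, Thm. 9.7); [GrossZagier1986] Thm. I.(6.3), I.§7, V.§2; [Gross1991] (1.1);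
[SilvermanAEC2009] IV.6.4, VII.6.3.
-/

set_option autoImplicit false

-- `Summit.BirchSwinnertonDyer.BirchSwinnertonDyer.…`: the summit and its single sub-problem share a name.
set_option linter.dupNamespace false

noncomputable section

open scoped Classical

open WeierstrassCurve NumberField
  Literature.NumberTheory.EllipticCurves
  Literature.NumberTheory.EllipticCurves.ModularForms
  Literature.NumberTheory.EllipticCurves.KrizLi2019
  Summit.BirchSwinnertonDyer.Rank1Residual

namespace Summit.BirchSwinnertonDyer.BirchSwinnertonDyer.Theorems.EisensteinPrimesMazurMCOnCellBTwistbackKrizLiPartner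

/-! ## §1. `log_{ω_E} P ≠ 0 ⟹ P` has infinite order -/

/-- **`log_{ω_E} P ≠ 0 ⟹ P ∈ E(K)` is of infinite order** (`W` globally minimal, `P ∈ E(K)` read in `E(ℚ_p)` along
`ιp : K →+* ℚ_p`): Castella's `log_{ω_E} P` IS the `ℤ_p`-linear formal logarithm of `P_ιp` (O5 glue
`padicLogOmega_eq_padicLog`), whose kernel is the torsion (`padicLog_eq_zero_iff`), and `P ↦ P_ιp` is additive, so a
torsion `P` has `log_{ω_E} P = 0`. The "In particular, `P` is of infinite order" sentence of Kriz–Li Thm. 1.20.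
[cite: SilvermanAEC2009, IV.6.4 and VII.6.3] [cite: KrizLi2019, Thm. 1.20 (p. 8, "In particular, P ∈ E(K) is of infinite order")] -/
theorem not_isOfFinAddOrder_of_padicLogOmega_ne_zero (W : WeierstrassCurve ℚ) [W.IsElliptic] [W.IsGloballyMinimal]
    (p : ℕ) [Fact p.Prime] {K : Type} [Field K] [NumberField K] (ιp : K →+* ℚ_[p])
    {P : (W.baseChange K).toAffine.Point} (h : Castella2018.padicLogOmega W p ιp P ≠ 0) :
    ¬ IsOfFinAddOrder P := by
  intro hP
  apply h
  rw [O5.HeegnerLogTransport.padicLogOmega_eq_padicLog, Additive.LocalLog.padicLog_eq_zero_iff]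
  exact (WeierstrassCurve.Affine.Point.map ιp.toRatAlgHom).isOfFinAddOrder hP

/-- **Kriz–Li Thm. 1.20's displayed conclusion ⟹ the Heegner point is of infinite order**:
`¬ ‖e · (log_{ω_𝓔} P / c)‖_p ≤ p⁻¹` (any prefactor `e`, any constant `c`) forces `log_{ω_𝓔} P ≠ 0`
(`KrizLi2019.padicLogOmega_ne_zero_of_not_norm_le`), hence `P ∉ E(K)_tors` (§1).
[cite: KrizLi2019, Thm. 1.20 (p. 8, "In particular, P ∈ E(K) is of infinite order")] -/
theorem not_isOfFinAddOrder_of_not_norm_le (W : WeierstrassCurve ℚ) [W.IsElliptic] [W.IsGloballyMinimal]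
    (p : ℕ) [Fact p.Prime] {K : Type} [Field K] [NumberField K] (ιp : K →+* ℚ_[p])
    {P : (W.baseChange K).toAffine.Point} {c : ℤ} {e : ℚ_[p]}
    (h : ¬ ‖e * (Castella2018.padicLogOmega W p ιp P / (c : ℚ_[p]))‖ ≤ (p : ℝ)⁻¹) :
    ¬ IsOfFinAddOrder P :=
  not_isOfFinAddOrder_of_padicLogOmega_ne_zero W p ιp (KrizLi2019.padicLogOmega_ne_zero_of_not_norm_le h)

/-! ## §2. `r_an(E) = 0` and a Heegner point of infinite order ⟹ `r_an(E^{(d_K)}) = 1` (Gross–Zagier + modularity) -/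

/-- **The partner's analytic rank from a Heegner point of infinite order.** `W/ℚ` globally minimal with
`ord_{s=1} L(E, s) = 0`; `K` imaginary quadratic with the Heegner hypothesis for `N_E`; `P ∈ E(K)` a Heegner point
of level `N_E` of infinite order. Then `ord_{s=1} L(E^{(d_K)}, s) = 1`: Gross–Zagier (`gross_zagier N_E W K`) with
the odd sign under the Heegner hypothesis (from modularity, `exists_isNewformOf`) gives `ord_{s=1} L(E/K, s) = 1 ⟺
P ∉ E(K)_tors` (tree `analyticRankEK_eq_one_iff_heegner_nonTorsion_of_exists_isNewformOf`), and the Artin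
factorisation `ord L(E/K) = ord L(E) + ord L(E^{(d_K)})` (tree `analyticRankEK_eq_add_of`) finishes. Literature-level
inputs only; no Kolyvagin, no GZK. [cite: GrossZagier1986, Thm. I.(6.3) with V.§2 and I.§7] [cite: Gross1991, (1.1)] -/
theorem analyticRank_twist_eq_one_of_isHeegnerPoint_of_not_isOfFinAddOrder
    (W : WeierstrassCurve ℚ) [W.IsElliptic] [W.IsGloballyMinimal] (K : Type) [Field K] [NumberField K]
    [NeZero (W.conductorNorm ℤ)]
    (hGZ : gross_zagier (W.conductorNorm ℤ) W K) (hnf : exists_isNewformOf)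
    (hK : IsImaginaryQuadratic K) (hH : SatisfiesHeegnerHypothesis (W.conductorNorm ℤ) K)
    (hr0 : W.analyticRank = 0) {P : (W.baseChange K).toAffine.Point}
    (hP : IsHeegnerPoint (W.conductorNorm ℤ) W K P) (hnt : ¬ IsOfFinAddOrder P) :
    (W.quadraticTwist (NumberField.discr K : ℚ)).analyticRank = 1 := by
  have h1 : analyticRankEK W K = 1 :=
    (analyticRankEK_eq_one_iff_heegner_nonTorsion_of_exists_isNewformOf W (W.conductorNorm ℤ) K hGZ hnf
      hK rfl hH hP).mpr hnt
  rw [analyticRankEK_eq_add_of (hasEntireLFunction_rat_of_exists_isNewformOf hnf) W K, hr0, zero_add] at h1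
  exact h1

/-! ## §3. Kriz–Li Thm. 1.20's "in particular" clause: `r_an(E^{(d_K)}) = 1` at a rank-zero curve -/

/-- **Kriz–Li 2019, Thm. 1.20 (= Thm. 7.1, first alternative), its printed "In particular, `P ∈ E(K)` is of infinite
order and `E/K` has analytic … rank `1`" clause in the tree's vocabulary, at a curve of analytic rank `0`.** For an
odd prime `p`; `W/ℚ` globally minimal of conductor `N` with `ord_{s=1} L(E, s) = 0`; a primitive Dirichlet character `ψ`
(conductor `f`, values in `ℚ_p`) and the Teichmüller character `ω` with `E[p]^{ss} ≅ 𝔽_p(ψ) ⊕ 𝔽_p(ψ⁻¹ω)` in trace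
form at the primes `ℓ ∤ pN`; Thm. 1.20's hypotheses (1) `ψ(p) ≠ 1 ≠ (ψ⁻¹ω)(p)`, (2) no split multiplicative
prime, (3) `ψ(ℓ) ≠ 1 ≠ (ψ⁻¹ω)(ℓ)` at the additive `ℓ ≠ p`; `K` imaginary quadratic, Heegner for `N`, `p` split, its
quadratic character `ε_K`, a parametrisation datum `D` at level `N`, a Heegner datum `H`, embeddings `ι`, `ιp`, the
Heegner point `P` (`ι(P) = heegnerPointComplex D H`), and the Bernoulli unit `B_{1,ψ₀⁻¹ε_K}·B_{1,ψ₀ω⁻¹} ≢ 0 (mod p)`: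
then `ord_{s=1} L(E^{(d_K)}, s) = 1`. Proof: the named fact `h120` gives `(|Ẽ^{ns}(𝔽_p)|/p)·log_{ω_E} P ≢ 0`, §1
makes `P` of infinite order, §2 (Gross–Zagier `hGZ` + modularity `hnf`) converts. NO hypothesis on the reduction of
`W` at `p` (FMS p. 42). SCOPE: hypotheses (2)+(3) force the local balance `c(E)` of p645419 §1 to be `0`, so
this does NOT serve the NON-split X2b pairs at `p = 3` (`c(E)` odd there; module docstring); it serves rank-zero
curves with no split multiplicative prime at an odd Eisenstein prime where (3) holds. CONDITIONAL on the named facts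
`h120`, `hGZ`, `hnf` (nothing asserted). [cite: KrizLi2019, Thm. 1.20 (pp. 7–8) = Thm. 7.1 first alternative (pp. 42–43), with "In particular … rank 1" (p. 8)]
[cite: GrossZagier1986, Thm. I.(6.3) with V.§2 and I.§7] -/
theorem analyticRank_twist_eq_one_of_thm120 (h120 : thm120_padicLogHeegner_unit_of_bernoulli)
    (p : ℕ) [Fact p.Prime] (hp2 : p ≠ 2)
    (W : WeierstrassCurve ℚ) [W.IsElliptic] [W.IsGloballyMinimal] [NeZero (W.conductorNorm ℤ)]
    (K : Type) [Field K] [NumberField K] [NeZero (NumberField.discr K).natAbs]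
    (hGZ : gross_zagier (W.conductorNorm ℤ) W K) (hnf : exists_isNewformOf)
    (f : ℕ) [NeZero f] (ψ : DirichletCharacter ℚ_[p] f) (ω : DirichletCharacter ℚ_[p] p)
    (hψ : ψ.IsPrimitive) (hω : IsTeichmullerCharacter ω)
    (htr : ∀ ℓ : ℕ, ℓ.Prime → ¬ (ℓ ∣ p * W.conductorNorm ℤ) →
      ‖((W.LFunction ℓ : ℤ) : ℚ_[p]) - (ψ (ℓ : ZMod f) + ψ⁻¹ (ℓ : ZMod f) * ω (ℓ : ZMod p))‖ < 1)
    (h1a : ψ (p : ZMod f) ≠ 1) (h1b : primVal (invMulOmega ψ ω) p ≠ 1)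
    (h2 : ∀ ℓ : ℕ, (hℓ : ℓ.Prime) → ¬ (haveI := Fact.mk hℓ; W.HasSplitMultiplicativeReductionAtPrime ℓ))
    (h3 : ∀ ℓ : ℕ, (hℓ : ℓ.Prime) → ℓ ≠ p →
      (haveI := Fact.mk hℓ; ¬ W.HasGoodReductionAtPrime ℓ ∧ ¬ W.HasMultiplicativeReductionAtPrime ℓ) →
      ψ (ℓ : ZMod f) ≠ 1 ∧ primVal (invMulOmega ψ ω) ℓ ≠ 1)
    (hK : IsImaginaryQuadratic K) (hH : SatisfiesHeegnerHypothesis (W.conductorNorm ℤ) K)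
    (hsplit : ((Ideal.span {(p : ℤ)}).primesOver (𝓞 K)).ncard = 2)
    (εK : DirichletCharacter ℚ_[p] (NumberField.discr K).natAbs) (hεK : IsKroneckerCharacterOf K εK)
    (D : ModularParametrizationData W (W.conductorNorm ℤ))
    (H : HeegnerDatum (W.conductorNorm ℤ) (NumberField.discr K)) (ι : K →+* ℂ) (ιp : K →+* ℚ_[p])
    (P : (W.baseChange K).toAffine.Point)
    (hPt : WeierstrassCurve.Affine.Point.map ι.toRatAlgHom P = heegnerPointComplex D H)
    (hB : ¬ (‖bernoulliOnePrim (bernoulliCharOne ψ εK) * bernoulliOnePrim (bernoulliCharTwo ψ εK ω)‖ ≤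
      (p : ℝ)⁻¹))
    (hr0 : W.analyticRank = 0) :
    (W.quadraticTwist (NumberField.discr K : ℚ)).analyticRank = 1 :=
  analyticRank_twist_eq_one_of_isHeegnerPoint_of_not_isOfFinAddOrder W K hGZ hnf hK hH hr0 ⟨D, H, ι, hPt⟩
    (not_isOfFinAddOrder_of_not_norm_le W p ιp
      (h120 p hp2 W f ψ ω hψ hω htr h1a h1b h2 h3 D K hK hH hsplit εK hεK H ι ιp P hPt hB))

end Summit.BirchSwinnertonDyer.BirchSwinnertonDyer.Theorems.EisensteinPrimesMazurMCOnCellBTwistbackKrizLiPartner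

end
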